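import Literature.Barriers.CriticalPhenomena.PlaquetteWalkHoleRootRowOnly
import HarnessLib

/-!
# Barrier catalogue (SAWScalingLimit): in the HOLE COLUMN the straight level-`7` class-`B2a` member has EXACTLY SEVEN isolated turns, named («HOLE COLUMN: THE SEVEN TURNS»)

`Z → ∞` limit model of the printed Yang–Baxter weights [GlazmanManolescu2019, §1, eq. (1)]; the «RECTANGLE COEFFICIENT» line (b-engine-1 g28). The EXPORT LEMMA of the
HOLE-COLUMN programme (FINDING-YB-HOLE-COLUMN-FOUR-PHASE; DESIGN-next b-engine-1 g28 §6–§7): the set-up that `PlaquetteWalkHoleRootHoleColumnDescent` (#1406) and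
`PlaquetteWalkHoleRootTailRootRow` (#1417, ed.2 p624879) each re-derive inside their proofs, stated once as a theorem so that the remaining frame cars import it:

* ★★★ `ΩG.sevenTurns_of_cost_seven_straight_holeColumn_above`: for a wound class-`B2a` walk of limit cost `7` from the hole root `w.side W` with a slanted end and a
  straight first arc at a hole-column rhombus `r` (`r.1 = w.1 − 1`) strictly above the hole, some arc strictly above the row of `r`: there are the top row `Y > r.2`, the
  bottom row `Y' < w.2`, two distinct top-row cells `t₁, t₂`, two distinct bottom-row cells `b₁, b₂`, a root-row cell `τ = (τ1, w.2)` with `τ1 ≥ w.1`, and the ends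
  `e_W = (r.1 − MW, r.2)`, `e_E = (r.1 + ME, r.2)` (`MW, ME ≥ 1`) of the horizontal chains of `r` (`r`'s `W`-chain cells use `E`/`W`, `e_W` does not use `W`; dually east),
  such that these seven cells are isolated turns (single plaquette configurations `u₁`/`u₂`) and EVERY isolated turn of the walk is one of them (`n_{u₁} + n_{u₂} = 7`).

[GlazmanManolescu2019 §1 Fig. 1, eq. (1), Lemma 2.1, Remark 2.2; Glazman2015WeightedSAW Lemma 3.1 (proof, pp. 6–7); CourantRobbins1958 Ch. V App. §2]
-/

noncomputable section

namespace Literature.Probability.RandomPlanarGeometry.SAW.YangBaxter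

open Real
open Literature.Barriers.CriticalPhenomena.PlaquetteWalk

open private fc_fh fh_add_Mv three_le_Mv from Literature.Probability.RandomPlanarGeometry.YangBaxterSAWGeneralDomain

namespace ΩG

variable {D : Set Face} {w r : Face} {ω : ΩG D (w.side .W) r}

/-- ★★★ **HOLE COLUMN: THE SEVEN TURNS (export lemma).** Let `ω` be a wound class-`B2a` walk of limit cost `7` from the hole root `w.side W` (hole `(w.1 − 1, w.2)` absent)
with a slanted end and a STRAIGHT first arc at a rhombus `r` of the hole column (`r.1 = w.1 − 1`) strictly above the hole, some arc of `ω` lying strictly above the row of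
`r`. Then with the top row `Y` (`r.2 < Y`), the bottom row `Y'` (`Y' < w.2`), two distinct top-row cells `t₁, t₂`, two distinct bottom-row cells `b₁, b₂`, a root-row cell
`(τ1, w.2)`, `τ1 ≥ w.1`, and the chain ends `(r.1 − MW, r.2)`, `(r.1 + ME, r.2)`, `MW, ME ≥ 1` (the cells `(r.1 − m, r.2)`, `1 ≤ m ≤ MW`, use `E`, those with `m < MW`
use `W`, the end does not use `W`; dually to the east): the seven cells are isolated turns — in `facesL` with plaquette word `[corner]` or `[coCorner]` — and every
isolated turn of `ω` is one of the seven. [cite: GlazmanManolescu2019, §1, Fig. 1 and eq. (1); Lemma 2.1; Remark 2.2] [cite: Glazman2015WeightedSAW, Lemma 3.1 (proof,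
pp. 6–7)] [cite: CourantRobbins1958, Ch. V Appendix §2 (the even–odd rule)] -/
theorem sevenTurns_of_cost_seven_straight_holeColumn_above (hh : holeFaceW w ∉ D) (hr : RootedFace D (w.side .W) r) (h : ω.IsB2a)
    (hA : ω.AJ hr h (toC (midPt (w.side .W))) ≠ 0) (hc : cost (slotOfSide ω.1) ω.2.mids = 7) (hz : ω.1 = .N ∨ ω.1 = .S)
    (hstr8 : arcKind (ω.2.sIn ω.2.firstHitG) (ω.2.sOut ω.2.firstHitG) = .straight) (hcol : r.1 = w.1 - 1) (habove : w.2 < r.2)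
    (hup : ∃ j < ω.2.arcs.length, r.2 < (ω.2.fc j).2) :
    ∃ (Y Y' τ1 : ℤ) (MW ME : ℕ) (t₁ t₂ b₁ b₂ : Face),
      (∀ j < ω.2.arcs.length, (ω.2.fc j).2 ≤ Y) ∧ (∀ j < ω.2.arcs.length, Y' ≤ (ω.2.fc j).2) ∧ r.2 < Y ∧ Y' < w.2 ∧
      t₁.2 = Y ∧ t₂.2 = Y ∧ t₁ ≠ t₂ ∧ b₁.2 = Y' ∧ b₂.2 = Y' ∧ b₁ ≠ b₂ ∧ w.1 ≤ τ1 ∧ 1 ≤ MW ∧ 1 ≤ ME ∧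
      (∀ m : ℕ, 1 ≤ m → m ≤ MW → ω.2.UsesSide (r.1 - m, r.2) .E) ∧ (∀ m : ℕ, m < MW → ω.2.UsesSide (r.1 - m, r.2) .W) ∧
        ¬ω.2.UsesSide (r.1 - MW, r.2) .W ∧
      (∀ m : ℕ, 1 ≤ m → m ≤ ME → ω.2.UsesSide (r.1 + m, r.2) .W) ∧ (∀ m : ℕ, m < ME → ω.2.UsesSide (r.1 + m, r.2) .E) ∧
        ¬ω.2.UsesSide (r.1 + ME, r.2) .E ∧
      (∀ f ∈ ({t₁, t₂, b₁, b₂, ((τ1 : ℤ), w.2), ((r.1 : ℤ) - MW, r.2), ((r.1 : ℤ) + ME, r.2)} : Finset Face),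
        f ∈ facesL ω.2.mids ∧ (kindsL ω.2.mids f = [.corner] ∨ kindsL ω.2.mids f = [.coCorner])) ∧
      (∀ f : Face, f ∈ facesL ω.2.mids → (kindsL ω.2.mids f = [.corner] ∨ kindsL ω.2.mids f = [.coCorner]) →
        f ∈ ({t₁, t₂, b₁, b₂, ((τ1 : ℤ), w.2), ((r.1 : ℤ) - MW, r.2), ((r.1 : ℤ) + ME, r.2)} : Finset Face)) := by
  classical
  set n := ω.2.arcs.length with hn
  ---------------------------------------------------------------- basics
  have hF := ω.fh_lt h
  have hlen : 0 < n := by omega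
  have h0w : ω.2.fc 0 = w := fc_zero_eq_root w hh ω.2 hlen
  have h0W : ω.2.sIn 0 = .W := YBWalk.sIn_zero_eq_W hh ω.2 hlen
  have h0E : ω.2.sIn 0 ≠ .E := by rw [h0W]; decide
  have h0N : ω.2.sIn 0 ≠ .N := by rw [h0W]; decide
  have h0S : ω.2.sIn 0 ≠ .S := by rw [h0W]; decide
  have hfcF := (fc_fh ω hr h).1
  have hsvr : ∀ l < n, ω.2.fc l = ω.2.fc ω.2.firstHitG → l = ω.2.firstHitG := fun l hl e => eq_firstHitG_of_fc_eq hr h hl e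
  have hfne3 : ω.2.firstHitG + 3 ≤ n := by have := three_le_Mv hr h; have := fh_add_Mv h; unfold ΩG.Mv at *; omega
  have hn1 : n - 1 < n := by omega
  have hlast := sOut_last_NS_of_slanted h hz
  have hzE : ω.2.sOut (n - 1) ≠ .E := by rcases hlast with e | e <;> rw [e] <;> decide
  have hzW : ω.2.sOut (n - 1) ≠ .W := by rcases hlast with e | e <;> rw [e] <;> decide
  have hlastr := fc_last_ne_root hr h
  have hLD : ω.2.fc (n - 1) ∈ D := (YBWalk.arcFace_arcAt hn1).2
  have hmemD : ∀ {c : Face} {s : Side}, ω.2.UsesSide c s → c ∈ D := by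
    intro c s hu
    obtain ⟨j, hj, hfj⟩ := ω.2.exists_fc_eq_of_usesSide hu
    rw [← hfj]; exact (YBWalk.arcFace_arcAt hj).2
  have hnotD : ∀ {c : Face}, c ∈ D → c = holeFaceW w → False := fun hc e => hh (e ▸ hc)
  have hzside : (ω.2.fc (n - 1)).side (ω.2.sOut (n - 1)) = r.side ω.1 := by
    obtain ⟨-, hout⟩ := ω.2.side_sIn_eq_nth hn1
    rwa [show n - 1 + 1 = n by omega, ω.2.nth_length] at hout
  -- the side of `r` carrying the end is not used by the arc of `r`
  have hrside : ∀ s, ω.2.UsesSide r s → r.side s ≠ r.side ω.1 := by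
    rintro s ⟨l, hl, hfl, hs⟩ e
    have hl' := hsvr l hl (hfl.trans hfcF.symm)
    obtain ⟨hin, hout⟩ := ω.2.side_sIn_eq_nth hl
    rw [hfl] at hin hout
    rw [← ω.2.nth_length] at e
    rcases hs with hs | hs
    · rw [hs] at hin; have := ω.2.nth_inj (show l ≤ n by omega) le_rfl (hin.symm.trans e).symm.symm; omega
    · rw [hs] at hout; have := ω.2.nth_inj (show l + 1 ≤ n by omega) le_rfl (hout.symm.trans e).symm.symm; omega
  -- the last plaquette: `ω.1 = N`: `L = (r.1, r.2 + 1)`, left through `S`; `ω.1 = S`: `L = (r.1, r.2 − 1)`, left through `N`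
  have hLcases : (ω.1 = .N ∧ ω.2.sOut (n - 1) = .S ∧ ω.2.fc (n - 1) = (r.1, r.2 + 1)) ∨
      (ω.1 = .S ∧ ω.2.sOut (n - 1) = .N ∧ ω.2.fc (n - 1) = (r.1, r.2 - 1)) := by
    rcases hfc : ω.2.fc (n - 1) with ⟨x, y⟩
    rw [hfc] at hzside hlastr
    rcases r with ⟨r1, r2⟩
    simp only at hlastr ⊢
    generalize hs : ω.2.sOut (n - 1) = s at hzside hlast ⊢
    generalize ht : ω.1 = t at hzside hz ⊢
    rcases hz with rfl | rfl <;> rcases hlast with rfl | rfl <;>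
      simp only [Face.side, MidEdge.slant.injEq, Prod.mk.injEq, reduceCtorEq, false_and, and_false, true_and, false_or, or_false] at hzside ⊢
    · exact absurd (Prod.ext hzside.1 (by simp only; omega)) hlastr
    · refine ⟨?_, ?_⟩ <;> omega
    · refine ⟨?_, ?_⟩ <;> omega
    · exact absurd (Prod.ext hzside.1 (by simp only; omega)) hlastr
  ---------------------------------------------------------------- isolated turns: seven, as `P`-cells
  have h7 : cfgCount ω.2.mids [.corner] + cfgCount ω.2.mids [.coCorner] = 7 := by
    have hcost : cost (slotOfSide ω.1) ω.2.mids =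
        cfgCount ω.2.mids [.corner] + cfgCount ω.2.mids [.coCorner] + (1 - slotDeg (slotOfSide ω.1)) := rfl
    have hd : slotDeg (slotOfSide ω.1) = 1 := by rcases hz with e | e <;> rw [e] <;> rfl
    rw [hcost, hd] at hc; omega
  let P : Face → Prop := fun f => f ∈ facesL ω.2.mids ∧ (kindsL ω.2.mids f = [.corner] ∨ kindsL ω.2.mids f = [.coCorner])
  have hPiso : ∀ k < n, (∀ l < n, ω.2.fc l = ω.2.fc k → l = k) → arcKind (ω.2.sIn k) (ω.2.sOut k) ≠ .straight → P (ω.2.fc k) :=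
    fun k hk hsv hkind => isolated_turn hk hsv hkind
  have hle7 : ∀ T : Finset Face, (∀ f ∈ T, P f) → T.card ≤ 7 := by
    intro T hT; have := YBWalk.card_le_cfgCount_add ω.2.mids T hT; omega
  -- top and bottom turns
  obtain ⟨Y, hYw, hY, Tt, hTtP, hTtrow, hTtcard⟩ := two_top_turns hh hr h hA
  have hTt2 : 1 < Tt.card := by
    rcases hTtcard with h2 | ⟨-, hzv, -⟩
    · omega
    · exfalso; rcases hz with e | e <;> rcases hzv with e' | e' <;> rw [e] at e' <;> exact absurd e' (by decide)
  obtain ⟨t₁, ht₁, t₂, ht₂, ht12⟩ := Finset.one_lt_card.1 hTt2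
  have hPt₁ : P t₁ := hTtP t₁ ht₁
  have hPt₂ : P t₂ := hTtP t₂ ht₂
  have ht₁row : t₁.2 = Y := hTtrow t₁ ht₁
  have ht₂row : t₂.2 = Y := hTtrow t₂ ht₂
  obtain ⟨Y', hY'w, hY', Tb, hTbP, hTbrow, hTbcard⟩ := two_bottom_turns hh hr h hA
  have hTb2 : 1 < Tb.card := by
    rcases hTbcard with h2 | ⟨-, hzv, -⟩
    · omega
    · exfalso; rcases hz with e | e <;> rcases hzv with e' | e' <;> rw [e] at e' <;> exact absurd e' (by decide)
  obtain ⟨b₁, hb₁, b₂, hb₂, hb12⟩ := Finset.one_lt_card.1 hTb2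
  have hPb₁ : P b₁ := hTbP b₁ hb₁
  have hPb₂ : P b₂ := hTbP b₂ hb₂
  have hb₁row : b₁.2 = Y' := hTbrow b₁ hb₁
  have hb₂row : b₂.2 = Y' := hTbrow b₂ hb₂
  have hNtop := forall_top_ne_N hh hr h hY (by omega)
  obtain ⟨X', -, hX', -⟩ := exists_right_entry_turn hh hr h
  obtain ⟨X, hXw, hX, -⟩ := exists_left_entry_turn hh hr h hA
  have hrY : r.2 ≤ Y := by have := hY _ hF; rwa [hfcF] at this
  ---------------------------------------------------------------- the first turn and the root-row turn `τ = (τ1, w.2)`, `τ1 ≥ w.1`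
  have hexk : ∃ k, k < n ∧ arcKind (ω.2.sIn k) (ω.2.sOut k) ≠ .straight := by
    by_contra hnone
    push Not at hnone
    obtain ⟨hrun0, -⟩ := ω.2.initial_run hh hF (fun i hi => hnone i (by omega))
    have e := (hrun0 ω.2.firstHitG le_rfl).1
    rw [hfcF] at e
    have := congrArg Prod.snd e; simp only at this; omega
  obtain ⟨hk₁, -⟩ := Nat.find_spec hexk
  set k₁ := Nat.find hexk with hk₁def
  have hstr : ∀ i < k₁, arcKind (ω.2.sIn i) (ω.2.sOut i) = .straight := by
    intro i hi; by_contra hne; exact Nat.find_min hexk hi ⟨by omega, hne⟩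
  obtain ⟨hrun, -⟩ := ω.2.initial_run hh hk₁ hstr
  obtain ⟨hfk, hWk⟩ := hrun k₁ le_rfl
  have hp₁W : ω.2.UsesSide (w.1 + k₁, w.2) .W := ⟨k₁, hk₁, hfk, Or.inl hWk⟩
  obtain ⟨τ1, hPτ, hτ1w⟩ : ∃ τ1 : ℤ, P (τ1, w.2) ∧ w.1 + k₁ ≤ τ1 := by
    by_cases hpE : ω.2.UsesSide (w.1 + k₁, w.2) .E
    · obtain ⟨M, hWall, -, hend⟩ := ω.2.chain_E hX' hpE
      rcases hend with ⟨hM1, hnot⟩ | ⟨-, hs0⟩ | ⟨-, hsZ⟩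
      · obtain ⟨i', hi', hfc', hsv', -, -, -, hk'⟩ := ω.2.isolated_of_usesSide_not_opp (hWall M hM1 le_rfl) hnot
        refine ⟨w.1 + k₁ + M, ?_, by omega⟩
        have := hPiso i' hi' hsv' hk'; rw [hfc'] at this; exact this
      · exact absurd hs0 h0E
      · exact absurd hsZ hzE
    · obtain ⟨i', hi', hfc', hsv', -, -, -, hk'⟩ := ω.2.isolated_of_usesSide_not_opp hp₁W hpE
      refine ⟨w.1 + k₁, ?_, le_rfl⟩
      have := hPiso i' hi' hsv' hk'; rw [hfc'] at this; exact this
  -- `r` is not in the top row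
  have hrtop : r.2 ≠ Y := by
    obtain ⟨j, hj, hjr⟩ := hup
    have := hY j hj
    omega
  have hr₂ : Y' < r.2 := by omega
  have hr₃ : r.2 < Y := lt_of_le_of_ne hrY hrtop
  ---------------------------------------------------------------- the arc of `r` is horizontal: `r` uses `W` and `E`; the ends `e_W`, `e_E` of its chains are isolated turns on the row of `r`
  have hrWE : ω.2.UsesSide r .W ∧ ω.2.UsesSide r .E := by
    have hne := ω.2.sIn_ne_sOut hF
    have hnoz : ¬(ω.2.sIn ω.2.firstHitG = ω.1 ∨ ω.2.sOut ω.2.firstHitG = ω.1) := fun hs => hrside ω.1 ⟨_, hF, hfcF, hs⟩ rfl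
    have key : ∀ t : Side, (t = .N ∨ t = .S) → ¬(ω.2.sIn ω.2.firstHitG = t ∨ ω.2.sOut ω.2.firstHitG = t) →
        arcKind (ω.2.sIn ω.2.firstHitG) (ω.2.sOut ω.2.firstHitG) = .straight → ω.2.sIn ω.2.firstHitG ≠ ω.2.sOut ω.2.firstHitG →
        (ω.2.sIn ω.2.firstHitG = .W ∨ ω.2.sOut ω.2.firstHitG = .W) ∧ (ω.2.sIn ω.2.firstHitG = .E ∨ ω.2.sOut ω.2.firstHitG = .E) := by
      intro t ht
      cases ω.2.sIn ω.2.firstHitG <;> cases ω.2.sOut ω.2.firstHitG <;> rcases ht with rfl | rfl <;> decide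
    obtain ⟨hW, hE⟩ := key ω.1 hz hnoz hstr8 hne
    exact ⟨⟨_, hF, hfcF, hW⟩, ⟨_, hF, hfcF, hE⟩⟩
  obtain ⟨hrW, hrE⟩ := hrWE
  obtain ⟨MW, hEW, hWW, hendW⟩ := ω.2.chain_W hX hrW
  obtain ⟨hMW1, hPeW, hnotW⟩ : 1 ≤ MW ∧ P (r.1 - MW, r.2) ∧ ¬ω.2.UsesSide (r.1 - MW, r.2) .W := by
    rcases hendW with ⟨hM1, hnot⟩ | ⟨hA0, -⟩ | ⟨-, hsZ⟩
    · obtain ⟨i', hi', hfc', hsv', -, -, -, hk'⟩ := ω.2.isolated_of_usesSide_not_opp (hEW MW hM1 le_rfl) hnot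
      refine ⟨hM1, ?_, hnot⟩
      have := hPiso i' hi' hsv' hk'; rw [hfc'] at this; exact this
    · exfalso; rw [h0w] at hA0; have := congrArg Prod.snd hA0; simp only at this; omega
    · exact absurd hsZ hzW
  obtain ⟨ME, hWE, hEE, hendE⟩ := ω.2.chain_E hX' hrE
  obtain ⟨hME1, hPeE, hnotE⟩ : 1 ≤ ME ∧ P (r.1 + ME, r.2) ∧ ¬ω.2.UsesSide (r.1 + ME, r.2) .E := by
    rcases hendE with ⟨hM1, hnot⟩ | ⟨-, hs0⟩ | ⟨-, hsZ⟩
    · obtain ⟨i', hi', hfc', hsv', -, -, -, hk'⟩ := ω.2.isolated_of_usesSide_not_opp (hWE ME hM1 le_rfl) hnot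
      refine ⟨hM1, ?_, hnot⟩
      have := hPiso i' hi' hsv' hk'; rw [hfc'] at this; exact this
    · exact absurd hs0 h0E
    · exact absurd hsZ hzE
  ---------------------------------------------------------------- every isolated turn is one of the seven
  have hne_of_row : ∀ f g : Face, f.2 ≠ g.2 → f ≠ g := fun f g hfg e => hfg (by rw [e])
  have hseven : ∀ f ∈ ({t₁, t₂, b₁, b₂, ((τ1 : ℤ), w.2), ((r.1 : ℤ) - MW, r.2), ((r.1 : ℤ) + ME, r.2)} : Finset Face), P f := by
    intro f hf
    simp only [Finset.mem_insert, Finset.mem_singleton] at hf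
    rcases hf with rfl | rfl | rfl | rfl | rfl | rfl | rfl
    exacts [hPt₁, hPt₂, hPb₁, hPb₂, hPτ, hPeW, hPeE]
  have hcard7 : ({t₁, t₂, b₁, b₂, ((τ1 : ℤ), w.2), ((r.1 : ℤ) - MW, r.2), ((r.1 : ℤ) + ME, r.2)} : Finset Face).card = 7 := by
    have h02 : t₁ ≠ b₁ := hne_of_row _ _ (by rw [ht₁row, hb₁row]; omega)
    have h03 : t₁ ≠ b₂ := hne_of_row _ _ (by rw [ht₁row, hb₂row]; omega)
    have h04 : t₁ ≠ ((τ1 : ℤ), w.2) := hne_of_row _ _ (by rw [ht₁row]; simp only; omega)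
    have h05 : t₁ ≠ ((r.1 : ℤ) - MW, r.2) := hne_of_row _ _ (by rw [ht₁row]; simp only; omega)
    have h06 : t₁ ≠ ((r.1 : ℤ) + ME, r.2) := hne_of_row _ _ (by rw [ht₁row]; simp only; omega)
    have h12 : t₂ ≠ b₁ := hne_of_row _ _ (by rw [ht₂row, hb₁row]; omega)
    have h13 : t₂ ≠ b₂ := hne_of_row _ _ (by rw [ht₂row, hb₂row]; omega)
    have h14 : t₂ ≠ ((τ1 : ℤ), w.2) := hne_of_row _ _ (by rw [ht₂row]; simp only; omega)
    have h15 : t₂ ≠ ((r.1 : ℤ) - MW, r.2) := hne_of_row _ _ (by rw [ht₂row]; simp only; omega)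
    have h16 : t₂ ≠ ((r.1 : ℤ) + ME, r.2) := hne_of_row _ _ (by rw [ht₂row]; simp only; omega)
    have h24 : b₁ ≠ ((τ1 : ℤ), w.2) := hne_of_row _ _ (by rw [hb₁row]; simp only; omega)
    have h25 : b₁ ≠ ((r.1 : ℤ) - MW, r.2) := hne_of_row _ _ (by rw [hb₁row]; simp only; omega)
    have h26 : b₁ ≠ ((r.1 : ℤ) + ME, r.2) := hne_of_row _ _ (by rw [hb₁row]; simp only; omega)
    have h34 : b₂ ≠ ((τ1 : ℤ), w.2) := hne_of_row _ _ (by rw [hb₂row]; simp only; omega)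
    have h35 : b₂ ≠ ((r.1 : ℤ) - MW, r.2) := hne_of_row _ _ (by rw [hb₂row]; simp only; omega)
    have h36 : b₂ ≠ ((r.1 : ℤ) + ME, r.2) := hne_of_row _ _ (by rw [hb₂row]; simp only; omega)
    have h45 : ((τ1 : ℤ), w.2) ≠ ((r.1 : ℤ) - MW, r.2) := hne_of_row _ _ (by simp only; omega)
    have h46 : ((τ1 : ℤ), w.2) ≠ ((r.1 : ℤ) + ME, r.2) := hne_of_row _ _ (by simp only; omega)
    have h56 : ((r.1 : ℤ) - MW, r.2) ≠ ((r.1 : ℤ) + ME, r.2) := by intro e; have := congrArg Prod.fst e; simp only at this; omega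
    rw [Finset.card_insert_of_notMem (by simp only [Finset.mem_insert, Finset.mem_singleton, not_or]; exact ⟨ht12, h02, h03, h04, h05, h06⟩),
      Finset.card_insert_of_notMem (by simp only [Finset.mem_insert, Finset.mem_singleton, not_or]; exact ⟨h12, h13, h14, h15, h16⟩),
      Finset.card_insert_of_notMem (by simp only [Finset.mem_insert, Finset.mem_singleton, not_or]; exact ⟨hb12, h24, h25, h26⟩),
      Finset.card_insert_of_notMem (by simp only [Finset.mem_insert, Finset.mem_singleton, not_or]; exact ⟨h34, h35, h36⟩),
      Finset.card_insert_of_notMem (by simp only [Finset.mem_insert, Finset.mem_singleton, not_or]; exact ⟨h45, h46⟩),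
      Finset.card_insert_of_notMem (by simp only [Finset.mem_singleton]; exact h56), Finset.card_singleton]
  have hall : ∀ f : Face, P f → f ∈ ({t₁, t₂, b₁, b₂, ((τ1 : ℤ), w.2), ((r.1 : ℤ) - MW, r.2), ((r.1 : ℤ) + ME, r.2)} : Finset Face) := by
    intro f hPf
    by_contra hnot
    have hT : ∀ g ∈ insert f ({t₁, t₂, b₁, b₂, ((τ1 : ℤ), w.2), ((r.1 : ℤ) - MW, r.2), ((r.1 : ℤ) + ME, r.2)} : Finset Face), P g := by
      intro g hg
      rw [Finset.mem_insert] at hg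
      rcases hg with rfl | hg
      · exact hPf
      · exact hseven g hg
    have := hle7 _ hT
    rw [Finset.card_insert_of_notMem hnot, hcard7] at this
    omega
  have hr₃ : r.2 < Y := lt_of_le_of_ne hrY hrtop
  exact ⟨Y, Y', τ1, MW, ME, t₁, t₂, b₁, b₂, hY, hY', hr₃, by omega, ht₁row, ht₂row, ht12, hb₁row, hb₂row, hb12, by omega, hMW1, hME1,
    hEW, hWW, hnotW, hWE, hEE, hnotE, hseven, fun f hf hk => hall f ⟨hf, hk⟩⟩

end ΩG

end Literature.Probability.RandomPlanarGeometry.SAW.YangBaxter
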